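import Literature.NumberTheory.Automorphic.UnitaryGroupArchFactor
import HarnessLib

/-!
# Slice continuity on `U(J)(𝔸_F)` at ONE complex place, generic rank `N`: a function with continuous
# `U(σ_{w₁}J)(ℂ)`-slices, right-invariant under the archimedean factor away from `w₁` and under an open
# subgroup of `U(J)(𝔸_{F,f})`, is continuous

For a number field `E` with an automorphism `c ≠ 1` over `F` fixing every infinite place (the CM situation), a matrix
`J ∈ M_N(E)` and ONE complex place `w₁` of `E`, write `ι_{w₁} := adelicSingle w₁ : U(σ_{w₁}J)(ℂ) →* U(J)(𝔸_F)` (★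
`UnitaryGroupArchSection`) and `K_c(w₁) := (ker archAt w₁).map archToAdelic ≅ ∏_{w ≠ w₁} U(σ_w J)(ℂ)` (written out, ★
`UnitaryGroupArchFactor`).  For ANY map `ψ : U(J)(𝔸_F) → X` into a topological space:

* `apply_eq_apply_finPart_mul_adelicSingle` — if `ψ` is right-`K_c(w₁)`-invariant then
  `ψ y = ψ ((1, y_f) · ι_{w₁}((y_∞)_{w₁}))` (the product decomposition ★ `UnitaryGroupArchFactor` (H6) and the commutations (H4), (H5));
* `continuous_of_continuous_adelicSingle_slice` — if moreover every slice `u ↦ ψ (x · ι_{w₁} u)` is continuous and `ψ` is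
  right-invariant under an OPEN `K_f ≤ U(J)(𝔸_{F,f})`, then `ψ` is continuous: near `x`, `y_f ∈ x_f K_f`, so `ψ` agrees with the
  continuous `y ↦ slice_{(1,x_f)} ((y_∞)_{w₁})` (`archPart`, `finPart`, `archAt w₁` are continuous);
* `continuous_of_continuous_adelicSingle_slice_cm` — the CM specialisation (`F = L⁺`, `c` = complex conjugation).

This is the standard «smooth vectors are continuous across the restricted product» remark of [BorelJacquet1979, §4.1–4.2]
(functions on `G(𝔸) = G(F_{v₁}) × ∏_{v ∣ ∞, v ≠ v₁} G(F_v) × G(𝔸_f)` right-invariant under a compact open subgroup of the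
last factor and under the middle factor are determined by, and as regular as, their `G(F_{v₁})`-slices), assembled ONCE at generic rank `N`; the rank-3 CM-frame
instance is ★ `Summits/…/Theorems/F0P2aL2bSliceContinuous.continuous_of_continuous_cmSlice`, whose proof this file transports to
`adelicSingle w₁` verbatim.  THEOREMS ONLY; no definition, no instance, no notation, no named fact, no `sorry`.

## References
* [BorelJacquet1979] A. Borel, H. Jacquet, *Automorphic forms and automorphic representations*, Corvallis PSPM 33.1, §4.1–4.2.
* [PlatonovRapinchuk1994] V. Platonov, A. Rapinchuk, *Algebraic groups and number theory*, §5.1 (the restricted product).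
-/

noncomputable section

open NumberField NumberField.InfinitePlace Topology Filter

open scoped Matrix MatrixGroups

namespace Literature.NumberTheory.Automorphic

namespace UnitaryGroup

variable (F E : Type) [Field F] [NumberField F] [Field E] [NumberField E] [Algebra F E]
  (c : E ≃ₐ[F] E) (N : ℕ) (J : Matrix (Fin N) (Fin N) E)
  (hc : c ≠ 1) (hfix : ∀ w : InfinitePlace E, c • w = w) (w₁ : {w : InfinitePlace E // IsComplex w})

/-- **Slice formula.**  If `ψ` is right-invariant under `K_c(w₁) = (ker archAt w₁).map archToAdelic`, then
`ψ y = ψ ((1, y_f) · adelicSingle w₁ ((y_∞)_{w₁}))`: by ★ (H6) `y = adelicSingle w₁ u · k · (1, y_f)` with `u = (y_∞)_{w₁}`,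
`k ∈ K_c(w₁)`, and `k`, `adelicSingle w₁ u` commute with `(1, y_f)` (★ (H5), (H4)). [cite: BorelJacquet1979, §4.1] -/
theorem apply_eq_apply_finPart_mul_adelicSingle {X : Type*} (ψ : (adelicGroupData F E c N J).Adelic → X)
    (hK : ∀ k ∈ ((archAt F E c N J w₁ (hfix w₁.1) hc).ker).map (archToAdelic F E c N J), ∀ x, ψ (x * k) = ψ x)
    (y : (adelicGroupData F E c N J).Adelic) :
    ψ y = ψ (finAdelicToAdelic F E c N J (finPart F E c N J y) *
      adelicSingle F E c N J hc hfix w₁ (archAt F E c N J w₁ (hfix w₁.1) hc (archPart F E c N J y))) := by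
  obtain ⟨a', ha', h⟩ := exists_eq_archSingle_mul F E c N J hc hfix w₁ (archPart F E c N J y)
  have hk : archToAdelic F E c N J a' ∈ ((archAt F E c N J w₁ (hfix w₁.1) hc).ker).map (archToAdelic F E c N J) :=
    ⟨a', MonoidHom.mem_ker.2 ha', rfl⟩
  have hy : y = finAdelicToAdelic F E c N J (finPart F E c N J y) *
      adelicSingle F E c N J hc hfix w₁ (archAt F E c N J w₁ (hfix w₁.1) hc (archPart F E c N J y)) *
        archToAdelic F E c N J a' := by
    conv_lhs => rw [← archToAdelic_mul_finAdelicToAdelic F E c N J y, h]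
    rw [map_mul, ← adelicSingle_apply, mul_assoc,
      mul_finAdelicToAdelic_of_mem_map_ker_archAt F E c N J hc hfix w₁ _ hk, ← mul_assoc,
      adelicSingle_mul_finAdelicToAdelic]
  conv_lhs => rw [hy]
  exact hK _ hk _

/-- **Slice-continuous + right-`K_c(w₁)`-invariant + right-`K_f`-invariant (open `K_f`) ⇒ CONTINUOUS on `U(J)(𝔸_F)`** (values in
any topological space).  Near `x`, `ψ y = slice_{(1,x_f)} ((y_∞)_{w₁})` because `x_f⁻¹ y_f ∈ K_f` eventually (`finPart` is continuous and
`K_f` is an open neighbourhood of `1`), and `y ↦ (y_∞)_{w₁} = archAt w₁ (archPart y)` is continuous. [cite: BorelJacquet1979, §4.1–4.2]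
[cite: PlatonovRapinchuk1994, §5.1] -/
theorem continuous_of_continuous_adelicSingle_slice {X : Type*} [TopologicalSpace X]
    (ψ : (adelicGroupData F E c N J).Adelic → X)
    (hslice : ∀ x, Continuous fun u : archLocal E N J w₁ => ψ (x * adelicSingle F E c N J hc hfix w₁ u))
    (hK : ∀ k ∈ ((archAt F E c N J w₁ (hfix w₁.1) hc).ker).map (archToAdelic F E c N J), ∀ x, ψ (x * k) = ψ x)
    (hKf : ∃ Kf : Subgroup (finAdelic F E c N J), IsOpen (Kf : Set (finAdelic F E c N J)) ∧
      ∀ k ∈ Kf, ∀ x, ψ (x * finAdelicToAdelic F E c N J k) = ψ x) :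
    Continuous ψ := by
  obtain ⟨Kf, hKo, hKf⟩ := hKf
  have hP : Continuous fun y : (adelicGroupData F E c N J).Adelic =>
      archAt F E c N J w₁ (hfix w₁.1) hc (archPart F E c N J y) :=
    (continuous_archAt F E c N J w₁ (hfix w₁.1) hc).comp (continuous_archPart F E c N J)
  refine continuous_iff_continuousAt.2 fun x => ?_
  -- the continuous candidate near `x`: the slice through `(1, x_f)` composed with `y ↦ (y_∞)_{w₁}`
  have hsl := hslice (finAdelicToAdelic F E c N J (finPart F E c N J x))
  have hN : ∀ᶠ y in 𝓝 x, finPart F E c N J (x⁻¹ * y) ∈ Kf := by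
    have hcf : Continuous fun y : (adelicGroupData F E c N J).Adelic => finPart F E c N J (x⁻¹ * y) :=
      (continuous_finPart F E c N J).comp (continuous_const.mul continuous_id)
    refine hcf.continuousAt.eventually_mem (hKo.mem_nhds ?_)
    show finPart F E c N J (x⁻¹ * x) ∈ (Kf : Set (finAdelic F E c N J))
    rw [inv_mul_cancel, map_one]
    exact Kf.one_mem
  have heq : (fun y => ψ (finAdelicToAdelic F E c N J (finPart F E c N J x) *
      adelicSingle F E c N J hc hfix w₁ (archAt F E c N J w₁ (hfix w₁.1) hc (archPart F E c N J y)))) =ᶠ[𝓝 x] ψ := by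
    filter_upwards [hN] with y hy
    rw [apply_eq_apply_finPart_mul_adelicSingle F E c N J hc hfix w₁ ψ hK y]
    have e : finPart F E c N J y = finPart F E c N J x * finPart F E c N J (x⁻¹ * y) := by
      rw [← map_mul, mul_inv_cancel_left]
    have e2 : finAdelicToAdelic F E c N J (finPart F E c N J y) *
        adelicSingle F E c N J hc hfix w₁ (archAt F E c N J w₁ (hfix w₁.1) hc (archPart F E c N J y)) =
        finAdelicToAdelic F E c N J (finPart F E c N J x) *
          adelicSingle F E c N J hc hfix w₁ (archAt F E c N J w₁ (hfix w₁.1) hc (archPart F E c N J y)) *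
          finAdelicToAdelic F E c N J (finPart F E c N J (x⁻¹ * y)) := by
      rw [e, map_mul, mul_assoc, mul_assoc, adelicSingle_mul_finAdelicToAdelic]
    rw [e2, hKf _ hy]
  exact (hsl.comp hP).continuousAt.congr heq

/-- **CM specialisation** (`F = L⁺`, `c` = complex conjugation, so `hc`, `hfix` are discharged by ★ `IsCMField.complexConj_ne_one` ∕
`complexConj_smul_infinitePlace`): a map on `U(H)(𝔸_{L⁺})` with continuous `adelicSingle w₁`-slices, right-invariant under the archimedean
factor away from `w₁` and under an open subgroup of `U(H)(𝔸_{L⁺,f})`, is continuous. [cite: BorelJacquet1979, §4.1–4.2] -/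
theorem continuous_of_continuous_adelicSingle_slice_cm (L : Type) [Field L] [NumberField L] [IsCMField L]
    (H : Matrix (Fin N) (Fin N) L) (w₁ : {w : InfinitePlace L // IsComplex w}) {X : Type*} [TopologicalSpace X]
    (ψ : (adelicGroupData (↥(maximalRealSubfield L)) L (IsCMField.complexConj L) N H).Adelic → X)
    (hslice : ∀ x, Continuous fun u : archLocal L N H w₁ => ψ (x * adelicSingle (↥(maximalRealSubfield L)) L
      (IsCMField.complexConj L) N H (IsCMField.complexConj_ne_one L) (complexConj_smul_infinitePlace L) w₁ u))
    (hK : ∀ k ∈ ((archAt (↥(maximalRealSubfield L)) L (IsCMField.complexConj L) N H w₁ (complexConj_smul_infinitePlace L w₁.1)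
      (IsCMField.complexConj_ne_one L)).ker).map (archToAdelic (↥(maximalRealSubfield L)) L (IsCMField.complexConj L) N H),
      ∀ x, ψ (x * k) = ψ x)
    (hKf : ∃ Kf : Subgroup (finAdelic (↥(maximalRealSubfield L)) L (IsCMField.complexConj L) N H),
      IsOpen (Kf : Set (finAdelic (↥(maximalRealSubfield L)) L (IsCMField.complexConj L) N H)) ∧
      ∀ k ∈ Kf, ∀ x, ψ (x * finAdelicToAdelic (↥(maximalRealSubfield L)) L (IsCMField.complexConj L) N H k) = ψ x) :
    Continuous ψ :=
  continuous_of_continuous_adelicSingle_slice (↥(maximalRealSubfield L)) L (IsCMField.complexConj L) N H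
    (IsCMField.complexConj_ne_one L) (complexConj_smul_infinitePlace L) w₁ ψ hslice hK hKf

end UnitaryGroup

end Literature.NumberTheory.Automorphic

end
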